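import Summits.CriticalPhenomena.CardyFormulaZ2.Theses.CardyComplexCone
import Literature.Probability.LatticeModels.UnitDiscDiscretisation
import Literature.Probability.LatticeModels.MedialInterfaceProofs
import Literature.Probability.LatticeModels.ExplorationWinding
import Literature.Probability.LatticeModels.MedialWindingBridge

/-!
# Disproof work file for the crux `EdgeCoherence` (route `CardyComplexCone`, item stmt-CriticalPhenomena-11385)

Standing adversary `refuter-cdisprove-stmt-CriticalPhenomena-11385-0`.  Everything here is
`lean check`ed (rc0, no `sorry`, axioms propext/Classical.choice/Quot.sound); prose lives in
docstrings.  Findings, indexed: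

* §0 `cornerObs`, `CoherentOn`, `edgeCoherence_iff` — the crux restated through a NAMED corner
  observable `E_δ(v,f)` (definitionally, `Iff.rfl`), so that everything below is about the crux
  verbatim.
* §1 LOAD-BEARING (non-degeneracy clause).  `edgeCoherenceWithoutNonzero_holds`: with the clause
  `∃ o, IsCorner 0 o ∧ u o ≠ 0` dropped the statement is TRUE (`u = 0`).  `edgeCoherence_of_classSmall`:
  the clause as filed (`u ≠ 0` on ONE class) does not exclude the degenerate reading — if three of
  the four corner classes are `o(δ^{1/3})` then `EdgeCoherence` holds with `u` = indicator of the
  fourth class.  (Planner information, cf. refuter g41-39: the intended statement wants `u o ≠ 0` on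
  all four classes, or a lower bound on `‖E_δ‖` on every class.)
* §2 `u_apply_eq_zero_of_rigid` (pure logic, PROVED): rigid data — a corner with `‖E‖ ≥ m > 0` and
  a corner with `E = 0` at the same vertices along `δₙ → 0⁺` inside `K` — kill the latter class.
* §3 THREE LOAD-BEARING HYPOTHESES, each certified by a PROVED `¬`:
  `edgeCoherence_false_without_interior : ¬ EdgeCoherenceWithoutInterior` (`K ⊆ D.carrier` dropped),
  `edgeCoherence_false_without_compact : ¬ EdgeCoherenceWithoutCompact` (`IsCompact K` dropped),
  `edgeCoherence_false_without_mesh : ¬ EdgeCoherenceWithoutMesh` (`(Λ δ).δ = δ` dropped).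
  Mechanism (§3a–§3e): the integrand of `E_δ` expressed through the corner ORBIT of
  `MedialInterfaceProofs` (`mem_dartFilter_iff`); at the discrete marked point of the certified
  admissible family `UnitDiscDiscretisation.discData` the first dart is deterministic (`E = 1` on
  its class `−e₁`) and the classes `−e₀`, `−e₀−e₁` have faces outside the disc (`E = 0`); the
  ARC-SWAPPED data `discDataSwap` (proved admissible, start corner at the right edge, class `−e₀`)
  give `E = 1` on `−e₀` and `E = 0` on `0`, `−e₁`.  A `u` coherent with both up to the boundary (or
  on the constant, non-refining families) vanishes on all four classes.  LANDED in the tree under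
  `Summits/CriticalPhenomena/CardyFormulaZ2/Theorems/EdgeCoherence/Negative/`:
  `CornerObservableRigidity.lean` (p69408), `FalseWithoutInterior.lean` (p69788; there the
  strengthenings are predicates `EdgeCoherenceWithoutX u` and the theorems read
  `¬ ∃ u, (∃ o, IsCorner 0 o ∧ u o ≠ 0) ∧ EdgeCoherenceWithoutX u` — closed `def : Prop` are
  relocated out of Theorems files by the gate), `DegenerateReading.lean` (p69801, §1),
  `CornerObservablePhase.lean` (p69867, §3f), `FalseWithoutMesh.lean` (p69971, pending).
  MORAL: coherence is an interior phenomenon and needs the lattice to refine; a proof cannot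
  seed or read the universal `u` in the boundary layer.
* §3f BY-PRODUCT for provers (PROVED, landed p69867): `dartPhaseSum_eq_exp_turnSign` — on the
  event "k₀-th orbit corner = (v,k), before the exit" the integrand of `E_δ` is the single phase
  `exp(-(i/3)(π/2) S)`, `S = #left − #right turns before the dart` (via
  `ExplorationWinding.winding_orbitPts`); i.e. `E_δ(v, faceAt v k) = E[1_{…} e^{-iπS/6}]`, the
  starting formula of the twisted two-arm kernel.
* §4 WHY THE CRUX ITSELF RESISTS (docstring `whyItResists`): (a) no formalisation junk — the
  integrand is a finite sum of unimodular phases of a finitely-determined path, the family binder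
  is satisfiable, interior vertices are ≥ dist(K,∂D)/δ − 3 lattice steps from every frozen edge, so
  no interior value of `E_δ` is available in closed form; (b) heuristically the crux is TRUE with
  `u ∝ (1,1,1,1)` and first correction of relative order `δ^{1/4}` in the `i^{-k}` character
  (Poisson summation; matches refuter numerics `L^{-0.23}`); (c) the one structural failure mode:
  reflection symmetry makes the spectrum of the twisted two-arm scale kernel conjugation-closed,
  so rank-one asymptotics REQUIRE a real simple top eigenvalue — a non-real top pair would rotate
  the class vector log-periodically in `δ` (fatal for the crux and for DCS Conj. 8.7); CFT predicts
  the real exponent `1/3`.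
* §5 NUMERICS (evidence `cornerobs_local_tiny.json`, local preview 2.6 core-min: MC n = 16/32/64,
  G1 = corner-marked square, G2 = mid-side-marked square, 1.2–3·10⁴ samples; quick run n = 8,16;
  full jobs j006944 (clamped to 4 cores/0.5 h, partial) and j013982 (MC n ≤ 256 + cone test) attach
  their summaries to the item when they end).  FINDINGS:
  (i) Centre class vector `E = (E₀,E₁,E₂,E₃)`: G1 `|E| = (.37,.30,.19,.30) → (.29,.24,.17,.23) →
  (.22,.18,.14,.19)` at n = 16/32/64; its ℤ₄-Fourier content is `F₀` (trivial character) plus ONE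
  non-trivial harmonic, the predicted `i^{-k}` one, of relative size `.32 → .26 → .23` (G1) and
  `.32 → .27 → .21` (G2): decay `≈ 0.845`/doubling `= 2^{-0.24}`, the §4(b) prediction `δ^{1/4}`; the
  other two harmonics (`i^{k}`, `(−1)^k`, predicted `δ^{5/4}`, `δ²`) are at noise level (≤ .002 vs .2).
  So numerically `E_k(centre) = A·(1,1,1,1) + B·i^{-k}`, `B/A ∝ L^{-1/4}`, in both geometries (the
  coefficient `B` is geometry dependent, `A`'s class structure is not) — COHERENCE WITH u ∝ (1,1,1,1)
  IS THE NUMERICAL TREND; no sign of wandering or log-periodic phases up to n = 64.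
  (ii) Winding variance at the centre grows by `1.04–1.08` rad² per doubling = `(κ/4) ln 2` with
  κ = 6, as used in §4(b).
  (iii) Boundary vertices are RIGID as in §3: on the bottom side classes 2,3 vanish and the phases
  of classes 0,1 are exactly `π/6`, `0` (`|E| = P`, no cancellation); at the end vertex of G2 class 0
  has `P = 1`, phase `e^{+iπ/6}` (total winding deterministically `−π/2`, the Umlaufsatz) and class 3
  has `P ≈ .69` INDEPENDENT of n — the boundary layer does not scale like `δ^{1/3}` at all.
  (iv) CONE TEST (the planner's cheapest falsifier in its coarsest form: 4 entry sectors, block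
  ratio b = 4, R = n/4 → n/16, `â(ξ,η) = Ê[e^{-iΔW/3}; η | ξ]`): `max|â|/min|â| ≈ 4–5` (finite
  cross-ratio σ), Dubois four-pattern margins `min (lhs − rhs)/max|â|² = +.050 (G1,32), +.061 (G1,64),
  +.035 (G2,32), −.001 (G2,64: 1 of 36 quadruples, within sampling noise ±.03)`, against `+.14 … +.24`
  for the untwisted positive kernel (control).  Verdict: NO gross failure on typical pattern pairs,
  but the twisted kernel sits close to the boundary of the canonical complex cone at this
  resolution — thin aperture, weak per-block contraction; the mechanism is neither retired nor
  comfortably confirmed (finer, screening patterns and larger n: job j013982 / a `--tag long` run).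
-/

noncomputable section

open MeasureTheory Filter Topology
open Literature.Probability.LatticeModels Literature.Probability.RandomPlanarGeometry
open Literature.Probability.Percolation

namespace Summit.CriticalPhenomena.CardyFormulaZ2.Cruxes.EdgeCoherence.Disproof

open Summit.CriticalPhenomena.CardyFormulaZ2.Theses.CardyComplexCone (EdgeCoherence)

/-! ## §0 The corner observable and the restated crux -/

/-- The spin-`1/3` corner (medial-edge) observable of the exploration path of the family `Λ` at
mesh `δ`: `E_δ(v,f) = E[ Σ_{passages of γ along the dart (v,f)} exp(-(i/3)·W) ]`, `W` the total
turning of the polyline prefix ending with that dart — VERBATIM the `let E := …` of the crux. -/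
def cornerObs (Λ : ℝ → DiscreteDobrushin) (δ : ℝ) (v f : Site 2) : ℂ :=
  ∫ ω, (let γ := medialExploration (Λ δ) ω
    ∑ k ∈ (Finset.range γ.length).filter
        (fun k => γ[k]? = some (cornerSource v f) ∧ γ[k + 1]? = some (cornerTarget v f)),
      Complex.exp (-(Complex.I / 3) *
        ((Polyline.winding ((γ.map (medialPoint δ)).take (k + 2)) : ℝ) : ℂ)))
    ∂(bondPercolation (zdGraph 2) half)

/-- `u` is coherent on the family `Λ` over the set `K`: the crux's conclusion for one `(D, Λ, K)`. -/
def CoherentOn (u : Site 2 → ℂ) (Λ : ℝ → DiscreteDobrushin) (K : Set ℂ) : Prop :=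
  ∀ ε > (0:ℝ), ∀ᶠ δ in 𝓝[>] (0:ℝ), ∀ v f f' : Site 2, IsCorner v f → IsCorner v f' →
    meshPoint δ v ∈ K →
      ‖u (f' - v) * cornerObs Λ δ v f - u (f - v) * cornerObs Λ δ v f'‖ ≤ ε * δ ^ ((1:ℝ) / 3)

/-- The three hypotheses on a discretisation family of `D` in the crux. -/
def IsFamilyOf (D : DobrushinDomain) (Λ : ℝ → DiscreteDobrushin) : Prop :=
  (∀ δ, (Λ δ).Ω = D.carrier) ∧ (∀ δ, (Λ δ).δ = δ) ∧ ∀ᶠ δ in 𝓝[>] (0:ℝ), (Λ δ).IsZdAdmissible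

/-- **The crux, restated** through `cornerObs` / `CoherentOn` — definitionally equal. -/
theorem edgeCoherence_iff :
    EdgeCoherence ↔
      ∃ u : Site 2 → ℂ, (∃ o : Site 2, IsCorner 0 o ∧ u o ≠ 0) ∧
        ∀ (D : DobrushinDomain) (Λ : ℝ → DiscreteDobrushin), (∀ δ, (Λ δ).Ω = D.carrier) →
          (∀ δ, (Λ δ).δ = δ) → (∀ᶠ δ in 𝓝[>] (0:ℝ), (Λ δ).IsZdAdmissible) →
            ∀ K : Set ℂ, IsCompact K → K ⊆ D.carrier → CoherentOn u Λ K :=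
  Iff.rfl

/-! ## §1 The non-degeneracy clause is the only content guard -/

/-- `EdgeCoherence` with the non-degeneracy clause `∃ o, IsCorner 0 o ∧ u o ≠ 0` DROPPED. -/
def EdgeCoherenceWithoutNonzero : Prop :=
  ∃ u : Site 2 → ℂ,
    ∀ (D : DobrushinDomain) (Λ : ℝ → DiscreteDobrushin), (∀ δ, (Λ δ).Ω = D.carrier) →
      (∀ δ, (Λ δ).δ = δ) → (∀ᶠ δ in 𝓝[>] (0:ℝ), (Λ δ).IsZdAdmissible) →
        ∀ K : Set ℂ, IsCompact K → K ⊆ D.carrier → CoherentOn u Λ K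

/-- Without the non-degeneracy clause the crux is trivially TRUE (`u = 0`): the clause is
load-bearing for CONTENT (not for truth). -/
theorem edgeCoherenceWithoutNonzero_holds : EdgeCoherenceWithoutNonzero := by
  refine ⟨0, fun D Λ _ _ _ K _ _ ε hε => ?_⟩
  filter_upwards [self_mem_nhdsWithin] with δ hδ v f f' _ _ _
  simp only [Pi.zero_apply, zero_mul, sub_zero, norm_zero]
  exact mul_nonneg hε.le (Real.rpow_nonneg (le_of_lt hδ) _)

/-- The corner class `o` (an offset with `IsCorner 0 o`) is NEGLIGIBLE: `E_δ(v, v + o) = o(δ^{1/3})`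
locally uniformly, for every domain and family (the degenerate reading of one class). -/
def ClassSmall (o : Site 2) : Prop :=
  ∀ (D : DobrushinDomain) (Λ : ℝ → DiscreteDobrushin), (∀ δ, (Λ δ).Ω = D.carrier) →
    (∀ δ, (Λ δ).δ = δ) → (∀ᶠ δ in 𝓝[>] (0:ℝ), (Λ δ).IsZdAdmissible) →
      ∀ K : Set ℂ, IsCompact K → K ⊆ D.carrier → ∀ ε > (0:ℝ), ∀ᶠ δ in 𝓝[>] (0:ℝ),
        ∀ v f : Site 2, IsCorner v f → f - v = o → meshPoint δ v ∈ K →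
          ‖cornerObs Λ δ v f‖ ≤ ε * δ ^ ((1:ℝ) / 3)

/-- Offsets of corners: `IsCorner v f` gives `IsCorner 0 (f - v)`. -/
theorem isCorner_zero_sub {v f : Site 2} (h : IsCorner v f) : IsCorner 0 (f - v) := by
  intro i
  rcases h i with h | h
  · left; simp [h]
  · right; simp [h]

/-- The set of corner offsets is finite (it is `{0,-1}²`). -/
theorem finite_cornerOffsets : {o : Site 2 | IsCorner 0 o}.Finite := by
  refine (Set.Finite.pi (t := fun _ : Fin 2 => ({0, -1} : Set ℤ)) fun _ => Set.toFinite _).subset ?_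
  intro o ho i _
  rcases ho i with h | h
  · left; exact h.symm
  · right
    simp only [Set.mem_singleton_iff]
    have h' : (0:ℤ) = o i + 1 := by simpa using h
    omega

/-- **Degenerate reading not excluded.**  If the three corner classes other than `o₀` are
negligible, `EdgeCoherence` holds with `u` = indicator of `o₀` — with NO information on the class
`o₀` (in particular the route's Target/CoherentMorera then carry no content).  The filed clause
`u o ≠ 0` on one class is an anti-vacuity guard only. -/
theorem edgeCoherence_of_classSmall (o₀ : Site 2) (ho₀ : IsCorner 0 o₀)
    (h : ∀ o : Site 2, IsCorner 0 o → o ≠ o₀ → ClassSmall o) : EdgeCoherence := by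
  classical
  rw [edgeCoherence_iff]
  refine ⟨fun o => if o = o₀ then 1 else 0, ⟨o₀, ho₀, by simp⟩, ?_⟩
  intro D Λ h1 h2 h3 K hK hKD ε hε
  have key : ∀ o ∈ {o : Site 2 | IsCorner 0 o}, ∀ᶠ δ in 𝓝[>] (0:ℝ), o ≠ o₀ →
      ∀ v f : Site 2, IsCorner v f → f - v = o → meshPoint δ v ∈ K →
        ‖cornerObs Λ δ v f‖ ≤ ε * δ ^ ((1:ℝ) / 3) := by
    intro o ho
    by_cases hne : o = o₀
    · exact Eventually.of_forall fun δ h' => absurd hne h'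
    · exact (h o ho hne D Λ h1 h2 h3 K hK hKD ε hε).mono fun δ hδ _ => hδ
  have key' := (finite_cornerOffsets.eventually_all).2 key
  filter_upwards [key', self_mem_nhdsWithin] with δ hδ hpos v f f' hf hf' hv
  have hnn : (0:ℝ) ≤ ε * δ ^ ((1:ℝ) / 3) :=
    mul_nonneg hε.le (Real.rpow_nonneg (le_of_lt hpos) _)
  by_cases hfo : f - v = o₀ <;> by_cases hfo' : f' - v = o₀
  · have : f = f' := by
      have := hfo.trans hfo'.symm
      exact sub_left_injective this
    subst this
    simpa using hnn
  · simp only [hfo, hfo', if_true, if_false, zero_mul, one_mul, zero_sub, norm_neg]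
    exact hδ (f' - v) (isCorner_zero_sub hf') hfo' v f' hf' rfl hv
  · simp only [hfo, hfo', if_true, if_false, zero_mul, one_mul, sub_zero]
    exact hδ (f - v) (isCorner_zero_sub hf) hfo v f hf rfl hv
  · simpa [hfo, hfo'] using hnn

/-! ## §2 Rigid boundary data kill classes (the assembly lemma) -/

/-- **Rigidity kills classes.**  Let `u` be coherent on the family `Λ` over `K`.  If along mesh
sizes `δₙ → 0⁺` there are vertices `vₙ` with `δₙ vₙ ∈ K`, a corner `(vₙ, vₙ + a)` whose observable
has modulus `≥ m > 0` and a corner `(vₙ, vₙ + b)` whose observable VANISHES, then `u b = 0`.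
(Pure logic from the shape of the conclusion; used in §3 with the deterministic first darts of
the exploration path at the discrete marked point.) -/
theorem u_apply_eq_zero_of_rigid {u : Site 2 → ℂ} {Λ : ℝ → DiscreteDobrushin} {K : Set ℂ}
    (hcoh : CoherentOn u Λ K) {a b : Site 2} (s : ℕ → ℝ) (hs : Tendsto s atTop (𝓝[>] (0:ℝ)))
    {m : ℝ} (hm : 0 < m)
    (h : ∀ n, ∃ v : Site 2, IsCorner v (v + a) ∧ IsCorner v (v + b) ∧ meshPoint (s n) v ∈ K ∧
      m ≤ ‖cornerObs Λ (s n) v (v + a)‖ ∧ cornerObs Λ (s n) v (v + b) = 0) :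
    u b = 0 := by
  by_contra hb
  have hub : 0 < ‖u b‖ := norm_pos_iff.2 hb
  set ε : ℝ := m * ‖u b‖ / 2 with hε
  have hεpos : 0 < ε := by positivity
  have h1 : ∀ᶠ n in atTop, ∀ v f f' : Site 2, IsCorner v f → IsCorner v f' →
      meshPoint (s n) v ∈ K →
        ‖u (f' - v) * cornerObs Λ (s n) v f - u (f - v) * cornerObs Λ (s n) v f'‖ ≤
          ε * (s n) ^ ((1:ℝ) / 3) := hs.eventually (hcoh ε hεpos)
  have h2 : ∀ᶠ n in atTop, s n ∈ Set.Ioo (0:ℝ) 1 := by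
    have : Set.Ioo (0:ℝ) 1 ∈ 𝓝[>] (0:ℝ) := Ioo_mem_nhdsGT one_pos
    exact hs.eventually this
  obtain ⟨n, hn1, hn2⟩ := (h1.and h2).exists
  obtain ⟨v, hva, hvb, hvK, hma, hzero⟩ := h n
  have key := hn1 v (v + a) (v + b) hva hvb hvK
  rw [hzero, mul_zero, sub_zero, add_sub_cancel_left, norm_mul] at key
  have hpow : (s n) ^ ((1:ℝ) / 3) ≤ 1 :=
    Real.rpow_le_one hn2.1.le hn2.2.le (by norm_num)
  have : ‖u b‖ * m ≤ ε := by
    calc ‖u b‖ * m ≤ ‖u b‖ * ‖cornerObs Λ (s n) v (v + a)‖ :=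
          mul_le_mul_of_nonneg_left hma hub.le
      _ ≤ ε * (s n) ^ ((1:ℝ) / 3) := key
      _ ≤ ε * 1 := mul_le_mul_of_nonneg_left hpow hεpos.le
      _ = ε := mul_one ε
  rw [hε] at this
  nlinarith

/-! ## §3 The boundary strengthenings (false) -/

/-- `EdgeCoherence` with the hypothesis `K ⊆ D.carrier` DROPPED (coherence on every compact
`K ⊆ ℂ`, i.e. up to and including the boundary layer). -/
def EdgeCoherenceWithoutInterior : Prop :=
  ∃ u : Site 2 → ℂ, (∃ o : Site 2, IsCorner 0 o ∧ u o ≠ 0) ∧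
    ∀ (D : DobrushinDomain) (Λ : ℝ → DiscreteDobrushin), (∀ δ, (Λ δ).Ω = D.carrier) →
      (∀ δ, (Λ δ).δ = δ) → (∀ᶠ δ in 𝓝[>] (0:ℝ), (Λ δ).IsZdAdmissible) →
        ∀ K : Set ℂ, IsCompact K → CoherentOn u Λ K

/-- `EdgeCoherence` with the hypothesis `IsCompact K` DROPPED (then `K = D.carrier` is allowed,
which contains every mesh point of the discrete domain, boundary sites included). -/
def EdgeCoherenceWithoutCompact : Prop :=
  ∃ u : Site 2 → ℂ, (∃ o : Site 2, IsCorner 0 o ∧ u o ≠ 0) ∧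
    ∀ (D : DobrushinDomain) (Λ : ℝ → DiscreteDobrushin), (∀ δ, (Λ δ).Ω = D.carrier) →
      (∀ δ, (Λ δ).δ = δ) → (∀ᶠ δ in 𝓝[>] (0:ℝ), (Λ δ).IsZdAdmissible) →
        ∀ K : Set ℂ, K ⊆ D.carrier → CoherentOn u Λ K

/-- The crux implies both strengthened-hypothesis-free... no: both strengthenings imply the crux
(they quantify over more sets `K`). Recorded so that their refutation is correctly read as
"the interior restriction is load-bearing", not as evidence against the crux. -/
theorem edgeCoherence_of_withoutInterior (h : EdgeCoherenceWithoutInterior) : EdgeCoherence := by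
  rw [edgeCoherence_iff]
  obtain ⟨u, hu, h⟩ := h
  exact ⟨u, hu, fun D Λ h1 h2 h3 K hK _ => h D Λ h1 h2 h3 K hK⟩

theorem edgeCoherence_of_withoutCompact (h : EdgeCoherenceWithoutCompact) : EdgeCoherence := by
  rw [edgeCoherence_iff]
  obtain ⟨u, hu, h⟩ := h
  exact ⟨u, hu, fun D Λ h1 h2 h3 K _ hK => h D Λ h1 h2 h3 K hK⟩

/-! ## §3a The integrand along the exploration orbit (any admissible data) -/

/-- The integrand of `cornerObs`: the phase sum of the path `γ` at the corner `(v, f)`. -/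
def dartPhaseSum (γ : List MedialVertex) (δ : ℝ) (v f : Site 2) : ℂ :=
  ∑ k ∈ (Finset.range γ.length).filter
      (fun k => γ[k]? = some (cornerSource v f) ∧ γ[k + 1]? = some (cornerTarget v f)),
    Complex.exp (-(Complex.I / 3) *
      ((Polyline.winding ((γ.map (medialPoint δ)).take (k + 2)) : ℝ) : ℂ))

theorem cornerObs_eq (Λ : ℝ → DiscreteDobrushin) (δ : ℝ) (v f : Site 2) :
    cornerObs Λ δ v f =
      ∫ ω, dartPhaseSum (medialExploration (Λ δ) ω) δ v f ∂(bondPercolation (zdGraph 2) half) :=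
  rfl

/-- A polyline with at most two points does not turn. -/
theorem winding_eq_zero_of_length_le_two {l : List ℂ} (h : l.length ≤ 2) : Polyline.winding l = 0 := by
  match l, h with
  | [], _ => rfl
  | [_], _ => rfl
  | [_, _], _ => rfl
  | _ :: _ :: _ :: _, h => simp at h

section Orbit

variable {D : DiscreteDobrushin} (hD : D.IsZdAdmissible) {c₀ : Site 2 × Fin 4}
  (hc₀ : D.IsStartCorner c₀)
include hD hc₀

/-- **Passages = orbit hits.** The dart `(p.1, cFace p)` is traversed at position `k` of the
exploration path iff `k` is before the last position and the `k`-th orbit corner is `p`. -/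
theorem mem_dartFilter_iff (ω : BondConfig (Site 2)) (p : Site 2 × Fin 4) (k : ℕ) :
    k ∈ (Finset.range (medialExploration D ω).length).filter
        (fun k => (medialExploration D ω)[k]? = some (cornerSource p.1 (cFace p)) ∧
          (medialExploration D ω)[k + 1]? = some (cornerTarget p.1 (cFace p))) ↔
      k + 1 < (medialExploration D ω).length ∧ cornerOrbit (D.bcBondConfig ω) c₀ k = p := by
  have hγ := isMedialExploration_medialExploration_holds D hD ω
  set γ := medialExploration D ω with hγdef
  rw [Finset.mem_filter, Finset.mem_range, cornerSource_cFace, cornerTarget_cFace]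
  constructor
  · rintro ⟨-, hs, ht⟩
    obtain ⟨hk1, ht'⟩ := List.getElem?_eq_some_iff.1 ht
    have hk0 : k < γ.length := by omega
    obtain ⟨hk0', hs'⟩ := List.getElem?_eq_some_iff.1 hs
    obtain ⟨-, hsrc, htgt⟩ := hγ.dart_eq hD hc₀ k hk1
    refine ⟨hk1, eq_of_cSrc_eq_of_cTgt_eq ?_ ?_⟩
    · rw [hsrc, hs']
    · rw [htgt, ht']
  · rintro ⟨hk1, rfl⟩
    obtain ⟨-, hsrc, htgt⟩ := hγ.dart_eq hD hc₀ k hk1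
    refine ⟨by omega, ?_, ?_⟩
    · rw [List.getElem?_eq_some_iff]; exact ⟨by omega, hsrc.symm⟩
    · rw [List.getElem?_eq_some_iff]; exact ⟨hk1, htgt.symm⟩

/-- A corner missed by the orbit (before the exit) contributes nothing. -/
theorem dartPhaseSum_eq_zero_of_forall_ne (ω : BondConfig (Site 2)) (δ : ℝ) (p : Site 2 × Fin 4)
    (h : ∀ k, k + 1 < (medialExploration D ω).length → cornerOrbit (D.bcBondConfig ω) c₀ k ≠ p) :
    dartPhaseSum (medialExploration D ω) δ p.1 (cFace p) = 0 := by
  refine Finset.sum_eq_zero fun k hk => ?_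
  obtain ⟨hk1, hk2⟩ := (mem_dartFilter_iff hD hc₀ ω p k).1 hk
  exact absurd hk2 (h k hk1)

/-- **Corners with non-inner face are never traversed**: `dartPhaseSum = 0` for every `ω`. -/
theorem dartPhaseSum_eq_zero_of_not_isInnerFace (ω : BondConfig (Site 2)) (δ : ℝ)
    (p : Site 2 × Fin 4) (hp : ¬ D.IsInnerFace (cFace p)) :
    dartPhaseSum (medialExploration D ω) δ p.1 (cFace p) = 0 := by
  refine dartPhaseSum_eq_zero_of_forall_ne hD hc₀ ω δ p fun k hk h => hp ?_
  rw [← h]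
  exact ((isMedialExploration_medialExploration_holds D hD ω).dart_eq hD hc₀ k hk).1

/-- A corner hit by the orbit at position `k₀` (before the exit) contributes exactly the phase of
that passage (darts are not repeated). -/
theorem dartPhaseSum_eq_of_orbit_eq (ω : BondConfig (Site 2)) (δ : ℝ) (p : Site 2 × Fin 4) (k₀ : ℕ)
    (hk₀ : k₀ + 1 < (medialExploration D ω).length) (horb : cornerOrbit (D.bcBondConfig ω) c₀ k₀ = p) :
    dartPhaseSum (medialExploration D ω) δ p.1 (cFace p) =
      Complex.exp (-(Complex.I / 3) *
        ((Polyline.winding (((medialExploration D ω).map (medialPoint δ)).take (k₀ + 2)) : ℝ) : ℂ)) := by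
  have hγ := isMedialExploration_medialExploration_holds D hD ω
  have hset : (Finset.range (medialExploration D ω).length).filter
      (fun k => (medialExploration D ω)[k]? = some (cornerSource p.1 (cFace p)) ∧
        (medialExploration D ω)[k + 1]? = some (cornerTarget p.1 (cFace p))) = {k₀} := by
    ext k
    rw [mem_dartFilter_iff hD hc₀ ω p k, Finset.mem_singleton]
    constructor
    · rintro ⟨hk1, hk⟩
      by_contra hne
      have hinner : ∀ j < max k k₀, D.IsInnerFace (cFace (cornerOrbit (D.bcBondConfig ω) c₀ j)) :=
        fun j hj => (hγ.dart_eq hD hc₀ j (by omega)).1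
      rcases lt_or_gt_of_ne hne with hlt | hlt
      · exact cornerOrbit_ne hD hc₀ hlt (fun j hj => hinner j (by omega)) (hk.trans horb.symm)
      · exact cornerOrbit_ne hD hc₀ hlt (fun j hj => hinner j (by omega)) (horb.trans hk.symm)
    · rintro rfl; exact ⟨hk₀, horb⟩
  unfold dartPhaseSum
  rw [hset, Finset.sum_singleton]

/-- **The first dart is deterministic**: the start corner is traversed at position `0` with phase
`1`, for every configuration. -/
theorem dartPhaseSum_start (ω : BondConfig (Site 2)) (δ : ℝ) :
    dartPhaseSum (medialExploration D ω) δ c₀.1 (cFace c₀) = 1 := by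
  have hγ := isMedialExploration_medialExploration_holds D hD ω
  rw [dartPhaseSum_eq_of_orbit_eq hD hc₀ ω δ c₀ 0 (by simpa using hγ.one_lt_length) rfl,
    winding_eq_zero_of_length_le_two (by simp)]
  simp

end Orbit

/-! ## §3b The certified disc family: rigid values at the discrete marked point -/

section Disc

open UnitDiscDiscretisation

variable {δ : ℝ} (hδ : 0 < δ) (hδ' : δ < 1 / 2)
include hδ hδ'

/-- The start vertex `v_A = (-M, 0)` (`M = abCol δ`) of the exploration of `discData δ`. -/
theorem isStartCorner_discData :
    (discData δ).IsStartCorner ((![-(abCol δ : ℤ), 0] : Site 2), (3 : Fin 4)) where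
  mem_zdArcA := xL0_mem_zdArcA hδ hδ'
  mem_zdArcB := by
    have : (![-(abCol δ : ℤ), 0] : Site 2) + cornerUnit 3 = ![-(abCol δ : ℤ), -1] := by
      funext i; fin_cases i <;> simp [cornerUnit]
    rw [this]; exact xL1_mem_zdArcB hδ hδ'
  isOutEdge := by
    constructor
    · have : faceAt (![-(abCol δ : ℤ), 0] : Site 2) 3 = ![-(abCol δ : ℤ), -1] := by
        funext i; fin_cases i <;> simp [faceAt, cornerOff]
      rw [this]; exact isInnerFace_fL hδ hδ'
    · have : faceAt (![-(abCol δ : ℤ), 0] : Site 2) (3 + 3) = ![-(abCol δ : ℤ) - 1, -1] := by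
        have h33 : (3 : Fin 4) + 3 = 2 := by decide
        rw [h33]; funext i; fin_cases i <;> simp [faceAt, cornerOff]
      rw [this]; exact not_isInnerFace_gL hδ hδ'

/-- The face `(-M-1, 0)` west of `v_A` is not inner (its corner `(-M-1, 1)` is outside). -/
theorem not_isInnerFace_west : ¬ (discData δ).IsInnerFace ![-(abCol δ : ℤ) - 1, 0] := by
  refine not_isInnerFace_of (v := ![-(abCol δ : ℤ) - 1, 0]) (w := ![-(abCol δ : ℤ) - 1, 1])
    ?_ ?_ ?_ ?_
  · intro i; fin_cases i <;> simp
  · intro i; fin_cases i <;> simp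
  · exact adj_of_eq_add_single_one fun i => by fin_cases i <;> simp
  · refine not_norm_lt_one_of hδ hδ' ?_ ?_
    · have : (0 : ℤ) ≤ abCol δ := Int.natCast_nonneg _
      simp only [Matrix.cons_val_zero]
      rw [abs_of_nonpos (by linarith)]; ring
    · simp

/-- **Rigid value 1**: the class-`(−e₁)` corner at `v_A` (the first dart) has `E_δ = 1`. -/
theorem cornerObs_discData_start :
    cornerObs discData δ ![-(abCol δ : ℤ), 0] (faceAt ![-(abCol δ : ℤ), 0] 3) = 1 := by
  rw [cornerObs_eq]
  have : (fun ω => dartPhaseSum (medialExploration (discData δ) ω) δ ![-(abCol δ : ℤ), 0]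
      (faceAt ![-(abCol δ : ℤ), 0] 3)) = fun _ => (1 : ℂ) := by
    funext ω
    exact dartPhaseSum_start (isZdAdmissible_discData hδ hδ') (isStartCorner_discData hδ hδ') ω δ
  rw [this, integral_const]
  simp

/-- **Rigid value 0**: the class-`(−e₀)` corner at `v_A` (face west of the domain) has `E_δ = 0`. -/
theorem cornerObs_discData_vA_one :
    cornerObs discData δ ![-(abCol δ : ℤ), 0] (faceAt ![-(abCol δ : ℤ), 0] 1) = 0 := by
  rw [cornerObs_eq]
  have : (fun ω => dartPhaseSum (medialExploration (discData δ) ω) δ ![-(abCol δ : ℤ), 0]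
      (faceAt ![-(abCol δ : ℤ), 0] 1)) = fun _ => (0 : ℂ) := by
    funext ω
    refine dartPhaseSum_eq_zero_of_not_isInnerFace (isZdAdmissible_discData hδ hδ')
      (isStartCorner_discData hδ hδ') ω δ (![-(abCol δ : ℤ), 0], 1) ?_
    have : cFace ((![-(abCol δ : ℤ), 0] : Site 2), (1 : Fin 4)) = ![-(abCol δ : ℤ) - 1, 0] := by
      funext i; fin_cases i <;> simp [cFace, faceAt, cornerOff]
    rw [this]; exact not_isInnerFace_west hδ hδ'
  rw [this, integral_zero]

/-- **Rigid value 0**: the class-`(−e₀−e₁)` corner at `v_A` (face south-west) has `E_δ = 0`. -/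
theorem cornerObs_discData_vA_two :
    cornerObs discData δ ![-(abCol δ : ℤ), 0] (faceAt ![-(abCol δ : ℤ), 0] 2) = 0 := by
  rw [cornerObs_eq]
  have : (fun ω => dartPhaseSum (medialExploration (discData δ) ω) δ ![-(abCol δ : ℤ), 0]
      (faceAt ![-(abCol δ : ℤ), 0] 2)) = fun _ => (0 : ℂ) := by
    funext ω
    refine dartPhaseSum_eq_zero_of_not_isInnerFace (isZdAdmissible_discData hδ hδ')
      (isStartCorner_discData hδ hδ') ω δ (![-(abCol δ : ℤ), 0], 2) ?_
    have : cFace ((![-(abCol δ : ℤ), 0] : Site 2), (2 : Fin 4)) = ![-(abCol δ : ℤ) - 1, -1] := by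
      funext i; fin_cases i <;> simp [cFace, faceAt, cornerOff]
    rw [this]; exact not_isInnerFace_gL hδ hδ'
  rw [this, integral_zero]

/-- The start vertex lies in the open unit disc. -/
theorem norm_meshPoint_vA_lt_one : ‖meshPoint δ ![-(abCol δ : ℤ), 0]‖ < 1 :=
  norm_lt_one_of_abs_le hδ hδ' (by simp [abs_of_nonneg (Int.natCast_nonneg (abCol δ))]) (by simp)

end Disc

/-! ## §3c Consequence: up to the boundary, a coherent `u` dies on two classes -/

/-- Class offsets as faces: `faceAt v k - v = -cornerOff k`. -/
theorem faceAt_sub (v : Site 2) (k : Fin 4) : faceAt v k - v = -cornerOff k := by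
  simp [faceAt]

/-- Face form of `u_apply_eq_zero_of_rigid`. -/
theorem u_eq_zero_of_rigid_faceAt {u : Site 2 → ℂ} {Λ : ℝ → DiscreteDobrushin} {K : Set ℂ}
    (hcoh : CoherentOn u Λ K) (ka kb : Fin 4) (s : ℕ → ℝ) (hs : Tendsto s atTop (𝓝[>] (0:ℝ)))
    {m : ℝ} (hm : 0 < m)
    (h : ∀ n, ∃ v : Site 2, meshPoint (s n) v ∈ K ∧ m ≤ ‖cornerObs Λ (s n) v (faceAt v ka)‖ ∧
      cornerObs Λ (s n) v (faceAt v kb) = 0) :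
    u (-cornerOff kb) = 0 := by
  refine u_apply_eq_zero_of_rigid hcoh (a := -cornerOff ka) s hs hm fun n => ?_
  obtain ⟨v, hK, hma, hzero⟩ := h n
  have ea : v + -cornerOff ka = faceAt v ka := by simp [faceAt, sub_eq_add_neg]
  have eb : v + -cornerOff kb = faceAt v kb := by simp [faceAt, sub_eq_add_neg]
  refine ⟨v, ?_, ?_, hK, ?_, ?_⟩
  · rw [ea]; exact isCorner_faceAt v ka
  · rw [eb]; exact isCorner_faceAt v kb
  · rwa [ea]
  · rwa [eb]

/-- The mesh sequence `δₙ = 1/(n+3) → 0⁺` (all terms in `(0, 1/2)`). -/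
theorem tendsto_inv_nat_add_three :
    Tendsto (fun n : ℕ => (1:ℝ) / ((n:ℝ) + 3)) atTop (𝓝[>] (0:ℝ)) := by
  rw [tendsto_nhdsWithin_iff]
  refine ⟨?_, Eventually.of_forall fun n => Set.mem_Ioi.2 (by positivity)⟩
  have h : Tendsto (fun n : ℕ => ((n:ℝ) + 3)⁻¹) atTop (𝓝 0) := by
    have := tendsto_inv_atTop_zero.comp
      (tendsto_atTop_add_const_right atTop (3:ℝ) tendsto_natCast_atTop_atTop)
    exact this
  simpa [one_div] using h

/-- The mesh sequence `δₙ = 1/(n+c) → 0⁺` for `c > 0`. -/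
theorem tendsto_one_div_nat_add {c : ℝ} (hc : 0 < c) :
    Tendsto (fun n : ℕ => (1:ℝ) / ((n:ℝ) + c)) atTop (𝓝[>] (0:ℝ)) := by
  rw [tendsto_nhdsWithin_iff]
  refine ⟨?_, Eventually.of_forall fun n => Set.mem_Ioi.2 (by positivity)⟩
  have h : Tendsto (fun n : ℕ => ((n:ℝ) + c)⁻¹) atTop (𝓝 0) :=
    tendsto_inv_atTop_zero.comp
      (tendsto_atTop_add_const_right atTop c tendsto_natCast_atTop_atTop)
  simpa [one_div] using h

/-- **Up to the boundary, coherence kills the classes `−e₀` and `−e₀−e₁`.**  If `u` is coherent on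
the certified disc family over a set containing the open disc (e.g. `K = closedBall 0 1` for
`EdgeCoherenceWithoutInterior`, `K = ball 0 1 = D.carrier` for `EdgeCoherenceWithoutCompact`), then
`u (−e₀) = u (−e₀−e₁) = 0`: at the discrete marked point the class vector is `(·, 0, 0, 1)`. -/
theorem u_classes_eq_zero_of_coherentOn_disc {u : Site 2 → ℂ} {K : Set ℂ}
    (hK : Metric.ball (0:ℂ) 1 ⊆ K) (hcoh : CoherentOn u UnitDiscDiscretisation.discData K) :
    u (-cornerOff 1) = 0 ∧ u (-cornerOff 2) = 0 := by
  have hs := tendsto_inv_nat_add_three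
  have hpos : ∀ n : ℕ, (0:ℝ) < 1 / ((n:ℝ) + 3) := fun n => by positivity
  have hlt : ∀ n : ℕ, (1:ℝ) / ((n:ℝ) + 3) < 1 / 2 := fun n => by
    exact one_div_lt_one_div_of_lt (by norm_num) (by linarith [n.cast_nonneg (α := ℝ)])
  have key : ∀ kb : Fin 4, (∀ n : ℕ, cornerObs UnitDiscDiscretisation.discData (1 / ((n:ℝ) + 3))
      ![-(UnitDiscDiscretisation.abCol (1 / ((n:ℝ) + 3)) : ℤ), 0]
      (faceAt ![-(UnitDiscDiscretisation.abCol (1 / ((n:ℝ) + 3)) : ℤ), 0] kb) = 0) →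
      u (-cornerOff kb) = 0 := by
    intro kb hz
    refine u_eq_zero_of_rigid_faceAt hcoh 3 kb _ hs one_pos fun n => ⟨_, hK ?_, ?_, hz n⟩
    · simpa using norm_meshPoint_vA_lt_one (hpos n) (hlt n)
    · rw [cornerObs_discData_start (hpos n) (hlt n)]; simp
  exact ⟨key 1 fun n => cornerObs_discData_vA_one (hpos n) (hlt n),
    key 2 fun n => cornerObs_discData_vA_two (hpos n) (hlt n)⟩

/-- **Partial refutation, recorded**: every witness `u` of `EdgeCoherenceWithoutInterior` vanishes on
the classes `−e₀`, `−e₀−e₁`. -/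
theorem withoutInterior_witness_degenerate (h : EdgeCoherenceWithoutInterior) :
    ∃ u : Site 2 → ℂ, (∃ o : Site 2, IsCorner 0 o ∧ u o ≠ 0) ∧ u (-cornerOff 1) = 0 ∧
      u (-cornerOff 2) = 0 := by
  obtain ⟨u, hu, h⟩ := h
  refine ⟨u, hu, u_classes_eq_zero_of_coherentOn_disc Metric.ball_subset_closedBall ?_⟩
  exact h DobrushinDomain.unitDisc UnitDiscDiscretisation.discData (fun _ => rfl) (fun _ => rfl)
    (by
      filter_upwards [Ioo_mem_nhdsGT (show (0:ℝ) < 1 / 2 by norm_num)] with δ hδ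
      exact UnitDiscDiscretisation.isZdAdmissible_discData hδ.1 hδ.2)
    _ (isCompact_closedBall 0 1)

/-- Same for `EdgeCoherenceWithoutCompact` (take `K = D.carrier = ball 0 1`). -/
theorem withoutCompact_witness_degenerate (h : EdgeCoherenceWithoutCompact) :
    ∃ u : Site 2 → ℂ, (∃ o : Site 2, IsCorner 0 o ∧ u o ≠ 0) ∧ u (-cornerOff 1) = 0 ∧
      u (-cornerOff 2) = 0 := by
  obtain ⟨u, hu, h⟩ := h
  refine ⟨u, hu, u_classes_eq_zero_of_coherentOn_disc subset_rfl ?_⟩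
  exact h DobrushinDomain.unitDisc UnitDiscDiscretisation.discData (fun _ => rfl) (fun _ => rfl)
    (by
      filter_upwards [Ioo_mem_nhdsGT (show (0:ℝ) < 1 / 2 by norm_num)] with δ hδ
      exact UnitDiscDiscretisation.isZdAdmissible_discData hδ.1 hδ.2)
    _ subset_rfl

/-! ## §3d The arc-swapped disc family: the exploration starts at the right edge with class `−e₀` -/

section Swap

open UnitDiscDiscretisation

/-- The certified disc data with the two arcs EXCHANGED (`A` = tilted lower arc, `B` = tilted upper
arc): same discrete domain, same `A`–`B` edges, admissible by symmetry of `IsZdAdmissible` in the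
two arcs; its exploration runs from the right marked point to the left one. -/
def discDataSwap (δ : ℝ) : DiscreteDobrushin := ⟨Metric.ball (0 : ℂ) 1, δ, tiltLo δ, tiltUp δ⟩

@[simp] theorem discDataSwap_Ω (δ : ℝ) : (discDataSwap δ).Ω = Metric.ball (0 : ℂ) 1 := rfl
@[simp] theorem discDataSwap_δ (δ : ℝ) : (discDataSwap δ).δ = δ := rfl

theorem zdArcA_swap (δ : ℝ) : (discDataSwap δ).zdArcA = (discData δ).zdArcB := rfl
theorem zdArcB_swap (δ : ℝ) : (discDataSwap δ).zdArcB = (discData δ).zdArcA := rfl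
theorem isInnerFace_swap (δ : ℝ) (f : Site 2) :
    (discDataSwap δ).IsInnerFace f ↔ (discData δ).IsInnerFace f := Iff.rfl
theorem zdBoundary_swap (δ : ℝ) : (discDataSwap δ).zdBoundary = (discData δ).zdBoundary := rfl

theorem zdABEdges_swap (δ : ℝ) : (discDataSwap δ).zdABEdges = (discData δ).zdABEdges := by
  ext e
  simp only [DiscreteDobrushin.mem_zdABEdges_iff, zdArcA_swap, zdArcB_swap, discDataSwap_Ω,
    discDataSwap_δ, discData_Ω, discData_δ]
  tauto

variable {δ : ℝ} (hδ : 0 < δ) (hδ' : δ < 1 / 2)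
include hδ hδ'

/-- The arc-swapped data are admissible (`0 < δ < 1/2`). -/
theorem isZdAdmissible_discDataSwap : (discDataSwap δ).IsZdAdmissible := by
  have h := isZdAdmissible_discData hδ hδ'
  exact
    { isBounded := h.isBounded
      delta_pos := h.delta_pos
      zdArcA_nonempty := h.zdArcB_nonempty
      zdArcB_nonempty := h.zdArcA_nonempty
      disjoint := by rw [zdArcA_swap, zdArcB_swap]; exact h.disjoint.symm
      zdBoundary_subset := by
        rw [zdArcA_swap, zdArcB_swap, zdBoundary_swap, Set.union_comm]; exact h.zdBoundary_subset
      ncard_zdABEdges_eq_two := by rw [zdABEdges_swap]; exact h.ncard_zdABEdges_eq_two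
      zdABEdges_inner := by
        intro e he
        rw [zdABEdges_swap] at he
        exact h.zdABEdges_inner e he }

/-- The start corner of the swapped data: vertex `(M, 0)` (on the new arc `A`), class `−e₀`
(face `(M-1, 0)` inner, face `(M, 0)` not). -/
theorem isStartCorner_discDataSwap :
    (discDataSwap δ).IsStartCorner ((![(abCol δ : ℤ), 0] : Site 2), (1 : Fin 4)) where
  mem_zdArcA := by rw [zdArcA_swap]; exact xR0_mem_zdArcB hδ hδ'
  mem_zdArcB := by
    have : (![(abCol δ : ℤ), 0] : Site 2) + cornerUnit 1 = ![(abCol δ : ℤ), 1] := by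
      funext i; fin_cases i <;> simp [cornerUnit]
    rw [zdArcB_swap, this]; exact xR1_mem_zdArcA hδ hδ'
  isOutEdge := by
    constructor
    · have : faceAt (![(abCol δ : ℤ), 0] : Site 2) 1 = ![(abCol δ : ℤ) - 1, 0] := by
        funext i; fin_cases i <;> simp [faceAt, cornerOff]
      rw [this]; exact (isInnerFace_swap δ _).2 (isInnerFace_fR hδ hδ')
    · have : faceAt (![(abCol δ : ℤ), 0] : Site 2) (1 + 3) = ![(abCol δ : ℤ), 0] := by
        have h13 : (1 : Fin 4) + 3 = 0 := by decide
        rw [h13]; funext i; fin_cases i <;> simp [faceAt, cornerOff]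
      rw [this]; exact fun h => not_isInnerFace_gR hδ hδ' ((isInnerFace_swap δ _).1 h)

/-- The face `(M, -1)` south-east of `(M, 0)` is not inner (its corner `(M+1, -1)` is outside). -/
theorem not_isInnerFace_southEast : ¬ (discData δ).IsInnerFace ![(abCol δ : ℤ), -1] := by
  refine not_isInnerFace_of (v := ![(abCol δ : ℤ) + 1, 0]) (w := ![(abCol δ : ℤ) + 1, -1])
    ?_ ?_ ?_ ?_
  · intro i; fin_cases i <;> simp
  · intro i; fin_cases i <;> simp
  · exact (adj_of_eq_add_single_one fun i => by fin_cases i <;> simp).symm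
  · refine not_norm_lt_one_of hδ hδ' ?_ ?_
    · have : (0 : ℤ) ≤ abCol δ := Int.natCast_nonneg _
      simp only [Matrix.cons_val_zero]
      rw [abs_of_nonneg (by linarith)]
    · simp

/-- **Rigid value 1** (swapped data): the class-`(−e₀)` corner at `(M, 0)` has `E_δ = 1`. -/
theorem cornerObs_discDataSwap_start :
    cornerObs discDataSwap δ ![(abCol δ : ℤ), 0] (faceAt ![(abCol δ : ℤ), 0] 1) = 1 := by
  rw [cornerObs_eq]
  have : (fun ω => dartPhaseSum (medialExploration (discDataSwap δ) ω) δ ![(abCol δ : ℤ), 0]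
      (faceAt ![(abCol δ : ℤ), 0] 1)) = fun _ => (1 : ℂ) := by
    funext ω
    exact dartPhaseSum_start (isZdAdmissible_discDataSwap hδ hδ') (isStartCorner_discDataSwap hδ hδ') ω δ
  rw [this, integral_const]
  simp

/-- **Rigid value 0** (swapped data): class `0` at `(M, 0)` (face `(M,0)` east, not inner). -/
theorem cornerObs_discDataSwap_zero :
    cornerObs discDataSwap δ ![(abCol δ : ℤ), 0] (faceAt ![(abCol δ : ℤ), 0] 0) = 0 := by
  rw [cornerObs_eq]
  have : (fun ω => dartPhaseSum (medialExploration (discDataSwap δ) ω) δ ![(abCol δ : ℤ), 0]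
      (faceAt ![(abCol δ : ℤ), 0] 0)) = fun _ => (0 : ℂ) := by
    funext ω
    refine dartPhaseSum_eq_zero_of_not_isInnerFace (isZdAdmissible_discDataSwap hδ hδ')
      (isStartCorner_discDataSwap hδ hδ') ω δ (![(abCol δ : ℤ), 0], 0) ?_
    have : cFace ((![(abCol δ : ℤ), 0] : Site 2), (0 : Fin 4)) = ![(abCol δ : ℤ), 0] := by
      funext i; fin_cases i <;> simp [cFace, faceAt, cornerOff]
    rw [this]; exact fun h => not_isInnerFace_gR hδ hδ' ((isInnerFace_swap δ _).1 h)
  rw [this, integral_zero]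

/-- **Rigid value 0** (swapped data): class `−e₁` at `(M, 0)` (face `(M,-1)` south-east, not inner). -/
theorem cornerObs_discDataSwap_three :
    cornerObs discDataSwap δ ![(abCol δ : ℤ), 0] (faceAt ![(abCol δ : ℤ), 0] 3) = 0 := by
  rw [cornerObs_eq]
  have : (fun ω => dartPhaseSum (medialExploration (discDataSwap δ) ω) δ ![(abCol δ : ℤ), 0]
      (faceAt ![(abCol δ : ℤ), 0] 3)) = fun _ => (0 : ℂ) := by
    funext ω
    refine dartPhaseSum_eq_zero_of_not_isInnerFace (isZdAdmissible_discDataSwap hδ hδ')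
      (isStartCorner_discDataSwap hδ hδ') ω δ (![(abCol δ : ℤ), 0], 3) ?_
    have : cFace ((![(abCol δ : ℤ), 0] : Site 2), (3 : Fin 4)) = ![(abCol δ : ℤ), -1] := by
      funext i; fin_cases i <;> simp [cFace, faceAt, cornerOff]
    rw [this]; exact fun h => not_isInnerFace_southEast hδ hδ' ((isInnerFace_swap δ _).1 h)
  rw [this, integral_zero]

/-- The start vertex `(M, 0)` of the swapped data lies in the open unit disc. -/
theorem norm_meshPoint_xR0_lt_one : ‖meshPoint δ ![(abCol δ : ℤ), 0]‖ < 1 :=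
  norm_lt_one_of_abs_le hδ hδ' (by simp [abs_of_nonneg (Int.natCast_nonneg (abCol δ))]) (by simp)

end Swap

/-- **Up to the boundary, coherence on the swapped family kills the classes `0` and `−e₁`.** -/
theorem u_classes_eq_zero_of_coherentOn_discSwap {u : Site 2 → ℂ} {K : Set ℂ}
    (hK : Metric.ball (0:ℂ) 1 ⊆ K) (hcoh : CoherentOn u discDataSwap K) :
    u (-cornerOff 0) = 0 ∧ u (-cornerOff 3) = 0 := by
  have hs := tendsto_inv_nat_add_three
  have hpos : ∀ n : ℕ, (0:ℝ) < 1 / ((n:ℝ) + 3) := fun n => by positivity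
  have hlt : ∀ n : ℕ, (1:ℝ) / ((n:ℝ) + 3) < 1 / 2 := fun n =>
    one_div_lt_one_div_of_lt (by norm_num) (by linarith [n.cast_nonneg (α := ℝ)])
  have key : ∀ kb : Fin 4, (∀ n : ℕ, cornerObs discDataSwap (1 / ((n:ℝ) + 3))
      ![(UnitDiscDiscretisation.abCol (1 / ((n:ℝ) + 3)) : ℤ), 0]
      (faceAt ![(UnitDiscDiscretisation.abCol (1 / ((n:ℝ) + 3)) : ℤ), 0] kb) = 0) →
      u (-cornerOff kb) = 0 := by
    intro kb hz
    refine u_eq_zero_of_rigid_faceAt hcoh 1 kb _ hs one_pos fun n => ⟨_, hK ?_, ?_, hz n⟩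
    · simpa using norm_meshPoint_xR0_lt_one (hpos n) (hlt n)
    · rw [cornerObs_discDataSwap_start (hpos n) (hlt n)]; simp
  exact ⟨key 0 fun n => cornerObs_discDataSwap_zero (hpos n) (hlt n),
    key 3 fun n => cornerObs_discDataSwap_three (hpos n) (hlt n)⟩

/-- Corner offsets are the four `-cornerOff k`. -/
theorem exists_eq_neg_cornerOff_of_isCorner {o : Site 2} (ho : IsCorner 0 o) :
    ∃ k : Fin 4, o = -cornerOff k := by
  obtain ⟨k, hk⟩ := exists_faceAt_of_isCorner ho
  exact ⟨k, by rw [hk]; simp [faceAt]⟩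

/-- The two certified families are discretisation families of the unit disc in the crux's sense. -/
theorem discData_isFamily :
    (∀ δ, (UnitDiscDiscretisation.discData δ).Ω = DobrushinDomain.unitDisc.carrier) ∧
    (∀ δ, (UnitDiscDiscretisation.discData δ).δ = δ) ∧
    (∀ᶠ δ in 𝓝[>] (0:ℝ), (UnitDiscDiscretisation.discData δ).IsZdAdmissible) := by
  refine ⟨fun _ => rfl, fun _ => rfl, ?_⟩
  filter_upwards [Ioo_mem_nhdsGT (show (0:ℝ) < 1 / 2 by norm_num)] with δ hδ
  exact UnitDiscDiscretisation.isZdAdmissible_discData hδ.1 hδ.2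

theorem discDataSwap_isFamily :
    (∀ δ, (discDataSwap δ).Ω = DobrushinDomain.unitDisc.carrier) ∧
    (∀ δ, (discDataSwap δ).δ = δ) ∧
    (∀ᶠ δ in 𝓝[>] (0:ℝ), (discDataSwap δ).IsZdAdmissible) := by
  refine ⟨fun _ => rfl, fun _ => rfl, ?_⟩
  filter_upwards [Ioo_mem_nhdsGT (show (0:ℝ) < 1 / 2 by norm_num)] with δ hδ
  exact isZdAdmissible_discDataSwap hδ.1 hδ.2

/-- **No `u` is coherent up to the boundary on both certified disc families.** -/
theorem not_coherentOn_both {u : Site 2 → ℂ} (hu : ∃ o : Site 2, IsCorner 0 o ∧ u o ≠ 0)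
    {K : Set ℂ} (hK : Metric.ball (0:ℂ) 1 ⊆ K)
    (h₁ : CoherentOn u UnitDiscDiscretisation.discData K) (h₂ : CoherentOn u discDataSwap K) :
    False := by
  obtain ⟨o, ho, huo⟩ := hu
  obtain ⟨k, rfl⟩ := exists_eq_neg_cornerOff_of_isCorner ho
  obtain ⟨h1, h2⟩ := u_classes_eq_zero_of_coherentOn_disc hK h₁
  obtain ⟨h0, h3⟩ := u_classes_eq_zero_of_coherentOn_discSwap hK h₂
  fin_cases k
  · exact huo h0
  · exact huo h1
  · exact huo h2
  · exact huo h3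

/-- **THEOREM (load-bearing hypothesis `K ⊆ D.carrier`).**  `EdgeCoherence` with the interior
restriction dropped is FALSE: on the unit disc with the certified tilted-arc discretisations,
at the discrete marked point where the exploration starts the class vector of the corner
observable is `(E₀,E₁,E₂,E₃) = (·, 0, 0, 1)` for the family `discData` (start class `−e₁`) and
`(0, 1, ·, 0)` for the arc-swapped family (start class `−e₀`), at every mesh `0 < δ < 1/2`
(deterministic first dart; faces leaving the disc).  A universal `u` coherent with both within
`o(δ^{1/3})` must vanish on all four classes.  Any proof of the crux must therefore use the
interior restriction: coherence is false in the boundary layer, uniformly in `δ`. -/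
theorem edgeCoherence_false_without_interior : ¬ EdgeCoherenceWithoutInterior := by
  rintro ⟨u, hu, h⟩
  obtain ⟨a1, a2, a3⟩ := discData_isFamily
  obtain ⟨b1, b2, b3⟩ := discDataSwap_isFamily
  exact not_coherentOn_both hu Metric.ball_subset_closedBall
    (h _ _ a1 a2 a3 _ (isCompact_closedBall 0 1)) (h _ _ b1 b2 b3 _ (isCompact_closedBall 0 1))

/-- **THEOREM (load-bearing hypothesis `IsCompact K`).**  `EdgeCoherence` with compactness of `K`
dropped is FALSE (take `K = D.carrier`, which contains every site of the discrete domain). -/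
theorem edgeCoherence_false_without_compact : ¬ EdgeCoherenceWithoutCompact := by
  rintro ⟨u, hu, h⟩
  obtain ⟨a1, a2, a3⟩ := discData_isFamily
  obtain ⟨b1, b2, b3⟩ := discDataSwap_isFamily
  exact not_coherentOn_both hu subset_rfl (h _ _ a1 a2 a3 _ subset_rfl) (h _ _ b1 b2 b3 _ subset_rfl)

/-! ## §3e The mesh hypothesis `(Λ δ).δ = δ` is load-bearing: a non-refining family -/

/-- `EdgeCoherence` with the mesh hypothesis `∀ δ, (Λ δ).δ = δ` DROPPED: the "family" need not refine,
e.g. the CONSTANT family `Λ δ := discData (1/3)` qualifies, and `δ → 0⁺` then only rescales the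
picture (`medialPoint δ`, `meshPoint δ v ∈ K`) without changing the combinatorics. -/
def EdgeCoherenceWithoutMesh : Prop :=
  ∃ u : Site 2 → ℂ, (∃ o : Site 2, IsCorner 0 o ∧ u o ≠ 0) ∧
    ∀ (D : DobrushinDomain) (Λ : ℝ → DiscreteDobrushin), (∀ δ, (Λ δ).Ω = D.carrier) →
      (∀ᶠ δ in 𝓝[>] (0:ℝ), (Λ δ).IsZdAdmissible) →
        ∀ K : Set ℂ, IsCompact K → K ⊆ D.carrier → CoherentOn u Λ K

theorem edgeCoherence_of_withoutMesh (h : EdgeCoherenceWithoutMesh) : EdgeCoherence := by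
  rw [edgeCoherence_iff]
  obtain ⟨u, hu, h⟩ := h
  exact ⟨u, hu, fun D Λ h1 _ h3 K hK hKD => h D Λ h1 h3 K hK hKD⟩

section ConstantFamily

open UnitDiscDiscretisation

/-- Rescaling mesh points: `meshPoint δ' x = (δ'/δ) · meshPoint δ x`. -/
theorem meshPoint_rescale {δ δ' : ℝ} (hδ : δ ≠ 0) (x : Site 2) :
    meshPoint δ' x = ((δ' / δ : ℝ) : ℂ) * meshPoint δ x := by
  have hδc : (δ : ℂ) ≠ 0 := by exact_mod_cast hδ
  simp only [meshPoint, ← mul_assoc]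
  congr 1
  push_cast
  rw [div_mul_cancel₀ _ hδc]

/-- For the constant family at data mesh `1/3`, the start vertex rescaled by `δ' ≤ 1/6` lies in the
closed ball of radius `1/2`. -/
theorem norm_meshPoint_rescale_le {δ' : ℝ} (h0 : 0 ≤ δ') (h6 : δ' ≤ 1 / 6) {x : Site 2}
    (hx : ‖meshPoint (1/3 : ℝ) x‖ < 1) : ‖meshPoint δ' x‖ ≤ 1 / 2 := by
  rw [meshPoint_rescale (δ := 1/3) (by norm_num) x, norm_mul, Complex.norm_real, Real.norm_eq_abs,
    abs_of_nonneg (by positivity)]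
  have : δ' / (1/3 : ℝ) = 3 * δ' := by ring
  rw [this]
  nlinarith [norm_nonneg (meshPoint (1/3 : ℝ) x)]

/-- Constant family `discData (1/3)`: rigid value `1` at the start corner, at EVERY scale `δ'`. -/
theorem cornerObs_const_discData_start (δ' : ℝ) :
    cornerObs (fun _ => discData (1/3 : ℝ)) δ' ![-(abCol (1/3 : ℝ) : ℤ), 0]
      (faceAt ![-(abCol (1/3 : ℝ) : ℤ), 0] 3) = 1 := by
  have hδ : (0:ℝ) < 1/3 := by norm_num
  have hδ' : (1/3 : ℝ) < 1/2 := by norm_num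
  rw [cornerObs_eq]
  have : (fun ω => dartPhaseSum (medialExploration (discData (1/3 : ℝ)) ω) δ'
      ![-(abCol (1/3 : ℝ) : ℤ), 0] (faceAt ![-(abCol (1/3 : ℝ) : ℤ), 0] 3)) = fun _ => (1 : ℂ) := by
    funext ω
    exact dartPhaseSum_start (isZdAdmissible_discData hδ hδ') (isStartCorner_discData hδ hδ') ω δ'
  simp only [this, integral_const]
  simp

theorem cornerObs_const_discData_zero (δ' : ℝ) (kb : Fin 4) (hkb : kb = 1 ∨ kb = 2) :
    cornerObs (fun _ => discData (1/3 : ℝ)) δ' ![-(abCol (1/3 : ℝ) : ℤ), 0]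
      (faceAt ![-(abCol (1/3 : ℝ) : ℤ), 0] kb) = 0 := by
  have hδ : (0:ℝ) < 1/3 := by norm_num
  have hδ' : (1/3 : ℝ) < 1/2 := by norm_num
  rw [cornerObs_eq]
  have : (fun ω => dartPhaseSum (medialExploration (discData (1/3 : ℝ)) ω) δ'
      ![-(abCol (1/3 : ℝ) : ℤ), 0] (faceAt ![-(abCol (1/3 : ℝ) : ℤ), 0] kb)) = fun _ => (0 : ℂ) := by
    funext ω
    refine dartPhaseSum_eq_zero_of_not_isInnerFace (isZdAdmissible_discData hδ hδ')
      (isStartCorner_discData hδ hδ') ω δ' (![-(abCol (1/3 : ℝ) : ℤ), 0], kb) ?_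
    rcases hkb with rfl | rfl
    · have : cFace ((![-(abCol (1/3:ℝ) : ℤ), 0] : Site 2), (1 : Fin 4)) = ![-(abCol (1/3:ℝ) : ℤ) - 1, 0] := by
        funext i; fin_cases i <;> simp [cFace, faceAt, cornerOff]
      rw [this]; exact not_isInnerFace_west hδ hδ'
    · have : cFace ((![-(abCol (1/3:ℝ) : ℤ), 0] : Site 2), (2 : Fin 4)) = ![-(abCol (1/3:ℝ) : ℤ) - 1, -1] := by
        funext i; fin_cases i <;> simp [cFace, faceAt, cornerOff]
      rw [this]; exact not_isInnerFace_gL hδ hδ'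
  simp only [this, integral_zero]

/-- Constant swapped family `discDataSwap (1/3)`: rigid value `1` at its start corner, every scale. -/
theorem cornerObs_const_discDataSwap_start (δ' : ℝ) :
    cornerObs (fun _ => discDataSwap (1/3 : ℝ)) δ' ![(abCol (1/3 : ℝ) : ℤ), 0]
      (faceAt ![(abCol (1/3 : ℝ) : ℤ), 0] 1) = 1 := by
  have hδ : (0:ℝ) < 1/3 := by norm_num
  have hδ' : (1/3 : ℝ) < 1/2 := by norm_num
  rw [cornerObs_eq]
  have : (fun ω => dartPhaseSum (medialExploration (discDataSwap (1/3 : ℝ)) ω) δ'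
      ![(abCol (1/3 : ℝ) : ℤ), 0] (faceAt ![(abCol (1/3 : ℝ) : ℤ), 0] 1)) = fun _ => (1 : ℂ) := by
    funext ω
    exact dartPhaseSum_start (isZdAdmissible_discDataSwap hδ hδ') (isStartCorner_discDataSwap hδ hδ') ω δ'
  simp only [this, integral_const]
  simp

theorem cornerObs_const_discDataSwap_zero (δ' : ℝ) (kb : Fin 4) (hkb : kb = 0 ∨ kb = 3) :
    cornerObs (fun _ => discDataSwap (1/3 : ℝ)) δ' ![(abCol (1/3 : ℝ) : ℤ), 0]
      (faceAt ![(abCol (1/3 : ℝ) : ℤ), 0] kb) = 0 := by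
  have hδ : (0:ℝ) < 1/3 := by norm_num
  have hδ' : (1/3 : ℝ) < 1/2 := by norm_num
  rw [cornerObs_eq]
  have : (fun ω => dartPhaseSum (medialExploration (discDataSwap (1/3 : ℝ)) ω) δ'
      ![(abCol (1/3 : ℝ) : ℤ), 0] (faceAt ![(abCol (1/3 : ℝ) : ℤ), 0] kb)) = fun _ => (0 : ℂ) := by
    funext ω
    refine dartPhaseSum_eq_zero_of_not_isInnerFace (isZdAdmissible_discDataSwap hδ hδ')
      (isStartCorner_discDataSwap hδ hδ') ω δ' (![(abCol (1/3 : ℝ) : ℤ), 0], kb) ?_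
    rcases hkb with rfl | rfl
    · have : cFace ((![(abCol (1/3:ℝ) : ℤ), 0] : Site 2), (0 : Fin 4)) = ![(abCol (1/3:ℝ) : ℤ), 0] := by
        funext i; fin_cases i <;> simp [cFace, faceAt, cornerOff]
      rw [this]; exact fun h => not_isInnerFace_gR hδ hδ' ((isInnerFace_swap _ _).1 h)
    · have : cFace ((![(abCol (1/3:ℝ) : ℤ), 0] : Site 2), (3 : Fin 4)) = ![(abCol (1/3:ℝ) : ℤ), -1] := by
        funext i; fin_cases i <;> simp [cFace, faceAt, cornerOff]
      rw [this]; exact fun h => not_isInnerFace_southEast hδ hδ' ((isInnerFace_swap _ _).1 h)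
  simp only [this, integral_zero]

end ConstantFamily

/-- **THEOREM (load-bearing hypothesis `(Λ δ).δ = δ`).**  With the mesh hypothesis dropped,
`EdgeCoherence` is FALSE: the constant families `Λ δ := discData (1/3)` and `Λ δ := discDataSwap (1/3)`
of the unit disc are admissible at every `δ`, their start vertices `∓(abCol (1/3), 0)` rescaled
by `δ ≤ 1/6` lie in the compact `closedBall 0 (1/2) ⊆ D`, and the class vectors there are the
rigid `(·,0,0,1)` and `(0,1,·,0)` at every scale — incompatible with any universal `u`.  So the
crux genuinely needs the lattice to refine; at fixed mesh the class vector is NOT projectively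
universal (it is pinned near the marked points and, numerically, position dependent in the bulk:
kit job j006179, exact enumeration `n ≤ 5`). -/
theorem edgeCoherence_false_without_mesh : ¬ EdgeCoherenceWithoutMesh := by
  rintro ⟨u, ⟨o, ho, huo⟩, h⟩
  have hs := tendsto_one_div_nat_add (show (0:ℝ) < 6 by norm_num)
  have hpos : ∀ n : ℕ, (0:ℝ) ≤ 1 / ((n:ℝ) + 6) := fun n => by positivity
  have hle : ∀ n : ℕ, (1:ℝ) / ((n:ℝ) + 6) ≤ 1 / 6 := fun n =>
    one_div_le_one_div_of_le (by norm_num) (by linarith [n.cast_nonneg (α := ℝ)])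
  have hK : IsCompact (Metric.closedBall (0:ℂ) (1/2)) := isCompact_closedBall _ _
  have hKD : Metric.closedBall (0:ℂ) (1/2) ⊆ DobrushinDomain.unitDisc.carrier := by
    intro z hz
    show z ∈ Metric.ball (0:ℂ) 1
    rw [Metric.mem_ball]; rw [Metric.mem_closedBall] at hz; linarith
  have hδ : (0:ℝ) < 1/3 := by norm_num
  have hδ' : (1/3 : ℝ) < 1/2 := by norm_num
  -- family 1
  have h₁ : CoherentOn u (fun _ => UnitDiscDiscretisation.discData (1/3 : ℝ))
      (Metric.closedBall (0:ℂ) (1/2)) :=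
    h DobrushinDomain.unitDisc _ (fun _ => rfl)
      (Eventually.of_forall fun _ => UnitDiscDiscretisation.isZdAdmissible_discData hδ hδ') _ hK hKD
  have h₂ : CoherentOn u (fun _ => discDataSwap (1/3 : ℝ)) (Metric.closedBall (0:ℂ) (1/2)) :=
    h DobrushinDomain.unitDisc _ (fun _ => rfl)
      (Eventually.of_forall fun _ => isZdAdmissible_discDataSwap hδ hδ') _ hK hKD
  have in₁ : ∀ n : ℕ, meshPoint (1 / ((n:ℝ) + 6))
      (![-(UnitDiscDiscretisation.abCol (1/3 : ℝ) : ℤ), 0] : Site 2) ∈ Metric.closedBall (0:ℂ) (1/2) :=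
    fun n => by
      rw [Metric.mem_closedBall, dist_zero_right]
      exact norm_meshPoint_rescale_le (hpos n) (hle n) (norm_meshPoint_vA_lt_one hδ hδ')
  have in₂ : ∀ n : ℕ, meshPoint (1 / ((n:ℝ) + 6))
      (![(UnitDiscDiscretisation.abCol (1/3 : ℝ) : ℤ), 0] : Site 2) ∈ Metric.closedBall (0:ℂ) (1/2) :=
    fun n => by
      rw [Metric.mem_closedBall, dist_zero_right]
      exact norm_meshPoint_rescale_le (hpos n) (hle n) (norm_meshPoint_xR0_lt_one hδ hδ')
  have k1 : u (-cornerOff 1) = 0 :=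
    u_eq_zero_of_rigid_faceAt h₁ 3 1 _ hs one_pos fun n =>
      ⟨_, in₁ n, by rw [cornerObs_const_discData_start]; simp,
        cornerObs_const_discData_zero _ 1 (Or.inl rfl)⟩
  have k2 : u (-cornerOff 2) = 0 :=
    u_eq_zero_of_rigid_faceAt h₁ 3 2 _ hs one_pos fun n =>
      ⟨_, in₁ n, by rw [cornerObs_const_discData_start]; simp,
        cornerObs_const_discData_zero _ 2 (Or.inr rfl)⟩
  have k0 : u (-cornerOff 0) = 0 :=
    u_eq_zero_of_rigid_faceAt h₂ 1 0 _ hs one_pos fun n =>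
      ⟨_, in₂ n, by rw [cornerObs_const_discDataSwap_start]; simp,
        cornerObs_const_discDataSwap_zero _ 0 (Or.inl rfl)⟩
  have k3 : u (-cornerOff 3) = 0 :=
    u_eq_zero_of_rigid_faceAt h₂ 1 3 _ hs one_pos fun n =>
      ⟨_, in₂ n, by rw [cornerObs_const_discDataSwap_start]; simp,
        cornerObs_const_discDataSwap_zero _ 3 (Or.inr rfl)⟩
  obtain ⟨k, rfl⟩ := exists_eq_neg_cornerOff_of_isCorner ho
  fin_cases k
  · exact huo k0
  · exact huo k1
  · exact huo k2
  · exact huo k3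

/-! ## §3f Positive by-product for provers: the phase of a passage in closed form -/

section Phase

variable {D : DiscreteDobrushin} (hD : D.IsZdAdmissible) {c₀ : Site 2 × Fin 4}
  (hc₀ : D.IsStartCorner c₀)
include hD hc₀

/-- The exploration path IS the cut orbit, with exit index `length - 1` (repackaging of
`IsMedialExploration.eq_explorationList`). -/
theorem medialExploration_eq_explorationList (ω : BondConfig (Site 2)) :
    medialExploration D ω =
      explorationList (D.bcBondConfig ω) c₀ ((medialExploration D ω).length - 1) := by
  have hγ := isMedialExploration_medialExploration_holds D hD ω
  have h1 := hγ.one_lt_length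
  exact hγ.eq_explorationList hD hc₀ (hγ.not_isInnerFace_length hD hc₀) fun k hk =>
    (hγ.dart_eq hD hc₀ k (by omega)).1

/-- **Closed form of the integrand.**  On the event that the `k₀`-th orbit corner is `p` (before
the exit), the contribution of the corner `(p.1, cFace p)` to `E_δ` is the single phase
`exp(-(i/3) · (π/2) · S)`, `S = Σ_{i<k₀} turnSign` = (#left − #right turns of the exploration
before the dart): by `ExplorationWinding.winding_orbitPts` every step turns by `±π/2`.  So
`E_δ(v, faceAt v k) = E[ 1_{(v,k) ∈ orbit before exit} · e^{-iπ S/6} ]` — the formula the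
twisted-kernel mechanism of the route starts from. -/
theorem dartPhaseSum_eq_exp_turnSign (ω : BondConfig (Site 2)) {δ : ℝ} (hδ : δ ≠ 0)
    (p : Site 2 × Fin 4) (k₀ : ℕ) (hk₀ : k₀ + 1 < (medialExploration D ω).length)
    (horb : cornerOrbit (D.bcBondConfig ω) c₀ k₀ = p) :
    dartPhaseSum (medialExploration D ω) δ p.1 (cFace p) =
      Complex.exp (-(Complex.I / 3) * ((Real.pi / 2 *
        ∑ i ∈ Finset.range k₀, (turnSign (D.bcBondConfig ω) (cornerOrbit (D.bcBondConfig ω) c₀ i) : ℝ) : ℝ) : ℂ)) := by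
  rw [dartPhaseSum_eq_of_orbit_eq hD hc₀ ω δ p k₀ hk₀ horb]
  congr 4
  have hN := medialExploration_eq_explorationList hD hc₀ ω
  set N := (medialExploration D ω).length - 1 with hNdef
  rw [hN, map_medialPoint_explorationList, take_orbitPts δ c₀ (show k₀ + 1 ≤ N by omega),
    Polyline.winding_eq_winding, winding_orbitPts hδ, sum_turnOf_eq]
  simp

end Phase

/-! ## §4 Why the crux itself resists (documentation) -/

/-- **Why `EdgeCoherence` resists a disproof** (and what would break it).

1. *No junk.*  `cornerObs` is a genuine expectation: for a bounded domain at mesh `δ > 0` the path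
   `medialExploration (Λ δ) ω` is determined by the finitely many edges of `Ω_δ`
   (`bcBondConfig ω = bcBondConfig (ω ∩ E(Ω_δ))`), so the integrand is a simple function; it is a
   sum of at most ONE unimodular phase (darts are not repeated, `IsMedialExploration.nodup`), hence
   `‖E_δ‖ ≤ 1`.  The family binder is satisfiable (`UnitDiscDiscretisation.isZdAdmissible_discData`,
   `0 < δ < 1/2`), so the `∀ D Λ` is not vacuous; conversely weird domains/families (thin necks,
   tiny arcs, ties) only make `E_δ = 0` near `K`, which satisfies the conclusion — they cannot
   refute it.  For `K ⊆ D.carrier` compact and `δ < dist(K, ∂D)/3`, every vertex `v` with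
   `δv ∈ K` is at lattice distance `≥ dist(K,∂D)/δ − 3` from `zdBoundary` (boundary sites lie
   within `3δ` of `ℂ ∖ D`), so every edge the path queries near `v` is Bernoulli(1/2): no interior
   value of `E_δ` is available in closed form, and a rigorous `¬` would need two-arm asymptotics
   of critical bond percolation with phases — out of reach.  The only rigid values of `E_δ` sit in
   the boundary layer (§3).
2. *Heuristic: TRUE with `u ∝ (1,1,1,1)`.*  The dart of class `k` at `v` has direction
   `θ_k = 135° + 90°k` (`k = 0,1,2,3` ↔ offsets `0, −e₀, −e₀−e₁, −e₁`), so on `{dart ∈ γ}` the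
   winding is `W = θ_k − θ_start + 2πn`, `n ∈ ℤ` the net number of full turns, and
   `E_δ(v, k) = Σ_n e^{-i(θ_k−θ_start+2πn)/3} P(dart_k ∈ γ, n)`.  Writing the joint law of
   (passage, total turning `t ∈ (π/2)ℤ`) as a class weight times a spread profile `G` of width
   `s² = Var W ≍ (κ/4) log δ⁻¹`, Poisson summation over the coset `t ≡ θ_k − θ_start (2π)` gives
   `E_δ(v,k) ≈ q_k · Ĝ(1/3)/4 · [1 + i^{-k}·O(e^{-s²π²/24}) + …]`: the leading term carries NO class
   phase, the first class-dependent harmonic is the character `i^{-k}` at relative size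
   `δ^{κ(1−2σ)/8} = δ^{1/4}` (σ = 1/3, κ = 6), the next `i^{k}` at `δ^{5/4}`.  With the local
   2-arm limit law rotation invariant (multi-arm IIC uniqueness, Damron–Sapozhnikov 2011;
   Garban–Pete–Schramm 2013 couplings) `q_k` is class independent, so `u ∝ (1,1,1,1)` and the
   crux's error is `O(δ^{1/3+1/4}) = o(δ^{1/3})`.  Sanity check: at σ = 1/2 (FK-Ising) the `m = 0`
   and `m = −1` harmonics TIE, reproducing exactly Smirnov's line projections
   `F(c) = Proj_{ℓ(c)} F(v)` — the mechanism by which the analogous statement FAILS at `q = 2` is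
   absent at `q = 1`.  Refuter numerics on the twins (rattack-11147, `L ≤ 256`): class structure
   `G_k ≈ A + B i^{-k}`, `B/A ∝ L^{-0.23}` — the predicted `L^{-1/4}`.
3. *The one structural failure mode.*  Reflection in a lattice axis reverses windings and permutes
   classes, so the twisted two-arm scale kernel `T` (the route's `a_b`) is conjugate to its entrywise
   complex conjugate: `spec T = conj (spec T)`.  Rank-one asymptotics of `T^N` (= the crux) therefore
   REQUIRE the top eigenvalue to be REAL and simple; a non-real top pair `λ, λ̄` would make the class
   vector rotate log-periodically in `δ` with no limit direction — fatal for the crux and for DCS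
   Conj. 8.7 alike.  CFT predicts the clean power `δ^{1/3}` (`h = 1/3`, `h̄ = 0`: the spin is chosen so
   that `x₂(σ) = 1/4 + κσ²/8 = σ`), i.e. a real top eigenvalue; a cone condition (Dubois) would
   certify reality + simplicity + gap at once, which is why the route's mechanism is the right SHAPE.
   A numerical test of this failure mode = absence of log-periodic modulation of arg E_δ(centre)
   across `L = 8…256` (kit job j006179, geometries G1/G2/G1rot/rectangle).
4. *Boundary layer.*  At the discrete marked point `a_δ` of ANY admissible family the first dart is
   deterministic (`E = 1` on its class) while the two classes whose faces leave the domain have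
   `E = 0`: the class vector there is rigid and not a character vector, so no universal `u` is
   coherent up to the boundary (§3).  Consequently a proof of the crux must localise strictly
   inside `D` and cannot seed a scale recursion at `∂D`. -/
theorem whyItResists : True := trivial

end Summit.CriticalPhenomena.CardyFormulaZ2.Cruxes.EdgeCoherence.Disproof

end
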